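import Summits.BirchSwinnertonDyer.BirchSwinnertonDyer.Theses.SlopeDichotomyA2
import Summits.BirchSwinnertonDyer.BirchSwinnertonDyer.Theses.EisensteinPrimes
import Summits.BirchSwinnertonDyer.Rank1Residual.X1.PadicSigmaThreeConsequences
import Literature.NumberTheory.EllipticCurves.KellerYin2024.AnomalousBSD
import Literature.NumberTheory.EllipticCurves.KatoRankBoundLevelZeroProofs
import Literature.NumberTheory.EllipticCurves.AnalyticRankOrderProofs
import Literature.NumberTheory.EllipticCurves.BSDRootNumberNoContinuationProofs
import HarnessLib

/-!
# PRINT PLACEMENT and ANALYTIC FACE of crux `DegenerateLocusA2` (route `SlopeDichotomyA2`, rung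
# I1-weaken, item stmt-BirchSwinnertonDyer-19086): the remaining BY-NAME edges of its placement lattice —
# the ANNOUNCED theorem Keller–Yin Thm. C (as printed) ⟹ the item; K5's crux 6 ⟹ the item outright;
# the item ⟸ `p`-adic BSD (i) on A2 (vacuity); and the item ⟺ «BSD(E,p) where `[T¹]L_p(E,α,T) = 0`»

Support file (prover seat `bsd-schneider-i1-c2`, gen 3, cell `bsd-schneider-ideate`; `--supports
stmt-BirchSwinnertonDyer-19086`). THEOREMS ONLY, each a few lines of logic over EXISTING named
statements; nothing unconditional about any curve, nothing booked; every open input enters BY NAME as a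
hypothesis. Companion of the gen-0/gen-2 files `Theorems/SlopeDichotomyA2DegenerateLocusA2Concrete.lean`
(the crux ⟺ an exact `p`-adic identity), `…AnticyclotomicRoad.lean` and `…Placement.lean` (the crux ⟺
K5's crux 5 `MazurMCOnX1RankZero` modulo Keller–Yin Thm. 3.0.8 at `𝟙` (`h308`) and published facts).

WHAT THIS FILE ADDS (for the frontier ledger of rung I1 and the route's tribunal T2/T5 print placement).
* §1 `typeBRankOneUnridered_of_thm421_pPart`, `degenerateLocusA2_of_thm421_pPart` — the COARSEST print
  placement: the rung-I1 leaf and the crux are special cases of the theorem ANNOUNCED in the preprint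
  Keller–Yin arXiv:2402.12781v2, Thm. 4.2.1 = Thm. C (the `p`-part of BSD at a good Eisenstein `p > 2`
  in analytic rank `≤ 1`, typed verbatim as the `_OPEN` hypothesis `KellerYin2024.thm421_pPart_OPEN`,
  `[claim: KellerYin2024, status: under-review]`), granted only modularity (`hasEntireLFunction_rat`)
  and Gross–Zagier–Kolyvagin (`rank_eq_analyticRank_of_analyticRank_le_one`) to pass from the print
  shape `PPart` to Miller's `BSDp` (`Rank1Residual.bsdp_of_pPart`). So the crux is NOT a free-standing
  conjecture: it is CLAIMED IN PREPRINT (arXiv-only as of 2026-08-26). Which links of that preprint's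
  proof are load-bearing for corner A2 (type B, `r_an = 1`: Thm. 3.0.8 at `𝟙` for the good lattice of the
  pair AND Mazur's main conjecture at the anomalous TYPE-A rank-`0` twist, v2 Thm. 3.0.10) is recorded
  in `KellerYin2024/AnomalousBSD.lean` and made by-name in the gen-2 files (item 19086 ⟺ item 19035
  modulo `h308` + PUB).
* §2 `degenerateLocusA2_of_schneiderOnX1TypeB`, `schneiderOnX1TypeB_iff_forall_not_degenerate` — the
  VACUITY edge, by name: K5's crux 6 `EisensteinPrimes.SchneiderOnX1TypeB` (item
  stmt-BirchSwinnertonDyer-19036: Schneider's non-degeneracy at every type-B rank-one X1 pair) says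
  exactly that the crux's degeneracy hypothesis is NEVER met, so it implies the crux with NO further
  input. Reading for the two planners: K5's registered line `theoremB` for crux 5 (stubs = crux 2 +
  crux 6 + PUB, seat k5-c5 2026-08-26) passes through a statement that kills rung I1's bridge condition
  outright, while the gen-2 road I1 ⟸ {crux 2, crux 5} needs no Schneider input at all — on class X1
  the two open sets {crux 2, crux 5} and {crux 2, crux 6} are interchangeable, and item 19086 lies
  below both.
* §3 The ANALYTIC FACE of the locus (companion of gen 0's height face
  `DegenerateLocusA2Concrete.degenerateLocusA2_iff_concrete`): at a pair of corner A2 the constant term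
  of the unit-root `p`-adic `L`-function vanishes (`r_an = 1`; tree theorems only —
  `constantCoeff_padicLFunction_eq_zero_of_typeBRankOne`), and a canonical datum violates Schneider iff
  the LINEAR coefficient vanishes too (`not_schneider_iff_coeff_one_eq_zero`, Perrin-Riou 1987 at odd `p`
  + GZK: `Wuthrich2014.coeff_one_padicLFunction_ne_zero_iff_schneider_odd`); at the level of the whole
  crux: `degenerateLocusA2_iff_coeffOne` (item 19086 ⟺ «`BSD(E,p)` at the A2 pairs with `[T¹]L_p = 0`»,
  modulo Perrin-Riou 1987 + GZK + modularity; THE canonical datum exists at odd `p` by the tree theorem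
  `X1.PadicSigmaThree.exists_isCanonical_odd`). Hence the degenerate locus is
  EXACTLY the set of A2 pairs with `ord_{T=0} L_p(E,α,T) ≥ 2 > 1 = rank E(ℚ)` — the failure set, inside
  A2, of clause (i) of the `p`-adic Birch–Swinnerton-Dyer conjecture bsd.S24 (Mazur–Tate–Teitelbaum,
  the tree's `PAdicBSDConjecture`): `not_pAdicBSDConjecture_of_degenerate` (at a degenerate A2 pair
  bsd.S24 fails for EVERY height datum) and `degenerateLocusA2_of_pAdicBSDConjecture` (item 19086 ⟸
  bsd.S24 at the canonical datum on corner A2 + Perrin-Riou 1987 + GZK + modularity, by vacuity). Ledger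
  sentence: rung I1-weaken's bridge condition asks for the CLASSICAL `p`-part of BSD at exactly those A2
  pairs that would be counterexamples to `p`-ADIC BSD (i); none is known (x1a's `[T¹] ≠ 0` certificates
  cover every census pair; gen 0's kit hunts j248697/j248754 found none among 5 853 further pairs).

References: [KellerYin2024] arXiv:2402.12781v2 Thm. 4.2.1 (= Thm. C), Thm. 3.0.8, Thm. 3.0.10;
[MazurTateTeitelbaum1986Invent] §I.14 (14.3), §II.10 Conj. BSD(p); [PerrinRiou1987] §1.4 Cor. 1.8;
[Miller2011LMS] Def. 1.1; [Darmon2004] Thm. 3.22; [Schneider1985] §2.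
-/

set_option autoImplicit false

noncomputable section

open scoped Classical MatrixGroups ModularForm

open CongruenceSubgroup WeierstrassCurve Literature.NumberTheory.EllipticCurves
  Literature.NumberTheory.EllipticCurves.ModularForms
  Literature.NumberTheory.EllipticCurves.Rank1Residual
  Summit.BirchSwinnertonDyer.Rank1Residual
  Summit.BirchSwinnertonDyer.BirchSwinnertonDyer.Theses
  Summit.BirchSwinnertonDyer.BirchSwinnertonDyer.Theorems

-- `Summit.BirchSwinnertonDyer.BirchSwinnertonDyer.…`: the summit and its single sub-problem share a name (D-0017 layout).
set_option linter.dupNamespace false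

namespace Summit.BirchSwinnertonDyer.BirchSwinnertonDyer.Theorems.DegenerateLocusA2PrintPlacement

/-! ## §1. The coarsest print placement: Keller–Yin's announced Thm. C ⟹ the leaf ⟹ the crux -/

/-- **Rung-I1 leaf ⟸ Keller–Yin Thm. C as printed (PREPRINT) + modularity + GZK.** Granted the ANNOUNCED
statement `KellerYin2024.thm421_pPart_OPEN` (arXiv:2402.12781v2 Thm. 4.2.1: the print shape `PPart W p`
for every globally minimal elliptic `W/ℚ`, prime `p ≠ 2` of good reduction with `E[p]` reducible and
`ord_{s=1} L(E,s) ≤ 1`; an unrefereed claim, taken as a hypothesis) and the PUBLISHED facts modularity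
(`hmod`) and Gross–Zagier–Kolyvagin (`hGZK`), Miller's `BSD(E,p)` holds at every pair of corner A2
(`X1.TypeBRankOne W p`: `2 < p`, `E[p]` reducible, good anomalous, Greenberg–Vatsal type B,
`r_an = 1`), i.e. the leaf `SchneiderWeaken.TypeBRankOneUnridered` — by `Rank1Residual.bsdp_of_pPart`.
CONDITIONAL RESULT on an unrefereed claim; credits nothing.
[claim: KellerYin2024, status: under-review] [cite: KellerYin2024, Thm. 4.2.1 (= Thm. C)]
[cite: Miller2011LMS, Def. 1.1] [cite: Darmon2004, Thm. 3.22] -/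
theorem typeBRankOneUnridered_of_thm421_pPart (hKY : KellerYin2024.thm421_pPart_OPEN)
    (hmod : hasEntireLFunction_rat) (hGZK : rank_eq_analyticRank_of_analyticRank_le_one) :
    SchneiderWeaken.TypeBRankOneUnridered := by
  intro W _ _ p _ hB
  obtain ⟨hX1, hr1, _⟩ := hB
  have hr : W.analyticRank ≤ 1 := le_of_eq hr1
  exact bsdp_of_pPart W p hmod hGZK hr (hKY W p hX1.1.ne' hX1.2.2.1 hX1.2.1 hr)

/-- **Item 19086 ⟸ Keller–Yin Thm. C as printed (PREPRINT) + modularity + GZK** — the crux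
`SlopeDichotomyA2.DegenerateLocusA2` (the `p`-part of BSD on the degenerate-height locus of corner A2)
is a special case of the announced theorem: drop the degeneracy hypothesis and apply
`typeBRankOneUnridered_of_thm421_pPart`. This is the COARSEST print placement of the item (it is
CLAIMED IN PREPRINT, not a free-standing conjecture); the finer placements are the gen-2 theorems
`DegenerateLocusA2AnticyclotomicRoad.degenerateLocusA2_of_h308_of_mazurMCOnX1RankZero` and
`DegenerateLocusA2Placement.degenerateLocusA2_iff_mazurMCOnX1RankZero`. CONDITIONAL RESULT on an
unrefereed claim; credits nothing.
[claim: KellerYin2024, status: under-review] [cite: KellerYin2024, Thm. 4.2.1 (= Thm. C)]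
[cite: Miller2011LMS, Def. 1.1] -/
theorem degenerateLocusA2_of_thm421_pPart (hKY : KellerYin2024.thm421_pPart_OPEN)
    (hmod : hasEntireLFunction_rat) (hGZK : rank_eq_analyticRank_of_analyticRank_le_one) :
    SlopeDichotomyA2.DegenerateLocusA2 :=
  fun W _ _ p _ hB _ ↦ typeBRankOneUnridered_of_thm421_pPart hKY hmod hGZK W p hB

/-! ## §2. The vacuity edge: K5's crux 6 `SchneiderOnX1TypeB` ⟹ the crux, with no further input -/

/-- **Item 19086 ⟸ item 19036 OUTRIGHT.** K5's crux 6 `EisensteinPrimes.SchneiderOnX1TypeB` (Schneider's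
non-degeneracy of THE canonical cyclotomic `p`-adic height at every type-B rank-one X1 pair: every
canonical `PAdicHeightData` satisfies `SchneiderConjecture`) contradicts the degeneracy hypothesis
`∃ Dh, Dh.IsCanonical ∧ ¬ SchneiderConjecture Dh` of the crux at every pair of corner A2, so the crux
holds vacuously — no published input, no `p`-adic `L`-function, no main conjecture. (The leaf itself
needs moreover the α-road's six published inputs: `SchneiderWeaken.leaf_of_rider`.) Pure logic.
[cite: Schneider1985, §2] -/
theorem degenerateLocusA2_of_schneiderOnX1TypeB (h6 : EisensteinPrimes.SchneiderOnX1TypeB) :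
    SlopeDichotomyA2.DegenerateLocusA2 := by
  intro W _ _ p _ hB hdeg
  obtain ⟨Dh, hDh, hnot⟩ := hdeg
  exact absurd (h6 W p hB Dh hDh) hnot

/-- **Crux 6 IS the emptiness of the crux's locus.** `EisensteinPrimes.SchneiderOnX1TypeB` holds iff at
NO pair of corner A2 a canonical `p`-adic height datum violates Schneider's conjecture — i.e. iff the
degenerate locus of route `SlopeDichotomyA2` is empty (the hypothesis of `DegenerateLocusA2` is never
met). Pure logic; recorded so that the two routes' ledgers name the same set. [cite: Schneider1985, §2] -/
theorem schneiderOnX1TypeB_iff_forall_not_degenerate :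
    EisensteinPrimes.SchneiderOnX1TypeB ↔
    ∀ (W : WeierstrassCurve ℚ) [W.IsElliptic] [W.IsGloballyMinimal] (p : ℕ) [Fact p.Prime],
      X1.TypeBRankOne W p →
        ¬ ∃ Dh : PAdicHeightData W p, Dh.IsCanonical ∧ ¬ SchneiderConjecture Dh := by
  constructor
  · intro h6 W _ _ p _ hB ⟨Dh, hDh, hnot⟩
    exact hnot (h6 W p hB Dh hDh)
  · intro h W _ _ p _ hB Dh hDh
    by_contra hnot
    exact h W p hB ⟨Dh, hDh, hnot⟩

/-- **The disjunction the two rungs share, by name.** At every pair of corner A2, EITHER every canonical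
datum satisfies Schneider (the α-road's certificate hypothesis, `X1.bsdp_of_typeBRankOne_of_schneider`)
OR the pair lies on the degenerate locus (the crux's hypothesis) — excluded middle, so that
`SlopeDichotomyA2.closes` / `SchneiderWeaken.leaf_of_degenerateLocus` and K5's crux 6 are seen to split
the SAME set. Pure logic. [folklore] -/
theorem schneider_or_degenerate (W : WeierstrassCurve ℚ) [W.IsElliptic] [W.IsGloballyMinimal]
    (p : ℕ) [Fact p.Prime] :
    (∀ Dh : PAdicHeightData W p, Dh.IsCanonical → SchneiderConjecture Dh) ∨
      ∃ Dh : PAdicHeightData W p, Dh.IsCanonical ∧ ¬ SchneiderConjecture Dh := by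
  by_cases h : ∀ Dh : PAdicHeightData W p, Dh.IsCanonical → SchneiderConjecture Dh
  · exact Or.inl h
  · push Not at h
    exact Or.inr h

/-! ## §3. The analytic face: the degenerate locus is the failure set of `p`-adic BSD (i) inside A2 -/

/-- **At a pair of corner A2 the constant term of `L_p(E,α,T)` vanishes.** `X1.TypeBRankOne W p` gives
`ord_{s=1} L(E,s) = 1`, hence an entire continuation (`hasEntireLFunction_of_analyticRank_ne_zero`) with
`L(E,1) = 0` (`analyticRank_eq_zero_iff_holds`), and good anomalous ⇒ ordinary, so for every newform `f`
of `E` the Mazur–Tate–Teitelbaum interpolation `L_p(E,0) = (1 − α⁻¹)² L(E,1)/Ω⁺_f`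
(`constantCoeff_padicLFunction_ne_zero_iff`) gives `[T⁰] L_p(f,α,T) = 0`. Tree theorems only — no
named fact. [cite: MazurTateTeitelbaum1986Invent, §I.14 (14.3)] -/
theorem constantCoeff_padicLFunction_eq_zero_of_typeBRankOne (W : WeierstrassCurve ℚ) [W.IsElliptic]
    [W.IsGloballyMinimal] (p : ℕ) [Fact p.Prime] (hB : X1.TypeBRankOne W p) {N : ℕ} [NeZero N]
    (f : CuspForm (Gamma0 N) 2) (hf : IsNewformOf W f) :
    PowerSeries.constantCoeff (padicLFunction f (unitRoot W p : ℚ_[p])) = 0 := by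
  obtain ⟨hX1, hr1, -⟩ := hB
  have hX := isClassX1_of_classX1 hX1
  have hord : IsOrdinaryAt W p := ⟨hX.hasGoodReductionAtPrime, hX.not_dvd_frobeniusTrace⟩
  have hne : W.analyticRank ≠ 0 := by rw [hr1]; exact one_ne_zero
  have hE : W.HasEntireLFunction := W.hasEntireLFunction_of_analyticRank_ne_zero hne
  have hL : W.entireLFunction 1 = 0 := by
    by_contra hL
    exact hne ((WeierstrassCurve.analyticRank_eq_zero_iff_holds (W := W) hE).mpr hL)
  by_contra hc
  exact (constantCoeff_padicLFunction_ne_zero_iff W p hord hf).mp hc hL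

/-- **Degenerate ⟺ the linear coefficient of `L_p(E,α,T)` vanishes** (at a pair of corner A2, for a
canonical datum `Dh` and any newform `f` of `E`): granted Perrin-Riou 1987 at odd `p` (`hPR`) and GZK
(`hGZK`), `¬ SchneiderConjecture Dh ↔ [T¹] L_p(f,α,T) = 0` — the contrapositive reading of the cell's
certificate lemma `Wuthrich2014.coeff_one_padicLFunction_ne_zero_iff_schneider_odd` (in rank one the
`[T¹]`-coefficient is a non-zero multiple of the canonical height of a generator). So gen 0's "number to
certify" `canonicalPAdicHeight p P` and x1a's certificate number `[T¹] L_p` cut out the same locus.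
[cite: PerrinRiou1987, §1.4 Cor. 1.8] [cite: SteinWuthrich2013, §§3–4] -/
theorem not_schneider_iff_coeff_one_eq_zero (hPR : perrinRiou_rankOne_leadingTerms_odd)
    (hGZK : rank_eq_analyticRank_of_analyticRank_le_one)
    (W : WeierstrassCurve ℚ) [W.IsElliptic] [W.IsGloballyMinimal] (p : ℕ) [Fact p.Prime]
    (hB : X1.TypeBRankOne W p) (Dh : PAdicHeightData W p) (hDh : Dh.IsCanonical) {N : ℕ} [NeZero N]
    (f : CuspForm (Gamma0 N) 2) (hf : IsNewformOf W f) :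
    ¬ SchneiderConjecture Dh ↔ PowerSeries.coeff 1 (padicLFunction f (unitRoot W p : ℚ_[p])) = 0 := by
  obtain ⟨hX1, hr1, -⟩ := hB
  have hX := isClassX1_of_classX1 hX1
  have hord : IsOrdinaryAt W p := ⟨hX.hasGoodReductionAtPrime, hX.not_dvd_frobeniusTrace⟩
  have key := Wuthrich2014.coeff_one_padicLFunction_ne_zero_iff_schneider_odd hPR hGZK W p hX.two_ne
    hord hr1 Dh hDh f hf
  rw [← key, not_ne_iff]

/-- **At a degenerate pair of corner A2, the `p`-adic Birch–Swinnerton-Dyer conjecture bsd.S24 FAILS —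
for every height datum.** If `X1.TypeBRankOne W p` and some canonical datum violates Schneider, then for
every `D : PAdicHeightData W p`, `¬ PAdicBSDConjecture W p D`: clause (i) of bsd.S24 demands
`ord_{T=0} L_p(f,α,T) = rank E(ℚ) = 1` (GZK), but `[T⁰] = 0`
(`constantCoeff_padicLFunction_eq_zero_of_typeBRankOne`) and `[T¹] = 0`
(`not_schneider_iff_coeff_one_eq_zero`), so the order is `≥ 2` (`PowerSeries.order_eq_nat`); a newform
`f` of `E` exists by modularity (`hmod`, `NeZero N_E` from `conductorNorm_pos_holds`). So the crux's
locus lies inside the counterexample set of Mazur–Tate–Teitelbaum (i) on A2.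
[cite: MazurTateTeitelbaum1986Invent, §II.10 Conj. BSD(p) (i)] [cite: PerrinRiou1987, §1.4 Cor. 1.8] -/
theorem not_pAdicBSDConjecture_of_degenerate (hPR : perrinRiou_rankOne_leadingTerms_odd)
    (hGZK : rank_eq_analyticRank_of_analyticRank_le_one) (hmod : exists_isNewformOf)
    (W : WeierstrassCurve ℚ) [W.IsElliptic] [W.IsGloballyMinimal] (p : ℕ) [Fact p.Prime]
    (hB : X1.TypeBRankOne W p)
    (hdeg : ∃ Dh : PAdicHeightData W p, Dh.IsCanonical ∧ ¬ SchneiderConjecture Dh)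
    (D : PAdicHeightData W p) : ¬ PAdicBSDConjecture W p D := by
  obtain ⟨Dh, hDh, hnot⟩ := hdeg
  have hX := isClassX1_of_classX1 hB.1
  have hr1 : W.analyticRank = 1 := hB.2.1
  have hord : IsOrdinaryAt W p := ⟨hX.hasGoodReductionAtPrime, hX.not_dvd_frobeniusTrace⟩
  haveI : NeZero (W.conductorNorm ℤ) := ⟨(W.conductorNorm_pos_holds).ne'⟩
  obtain ⟨f, hf⟩ := hmod W
  have h1 : PowerSeries.coeff 1 (padicLFunction f (unitRoot W p : ℚ_[p])) = 0 :=
    (not_schneider_iff_coeff_one_eq_zero hPR hGZK W p hB Dh hDh f hf).mp hnot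
  have hrank : W.mordellWeilRank = 1 := (hGZK W hr1.le).1.trans hr1
  intro hMTT
  have horder : (padicLFunction f (unitRoot W p : ℚ_[p])).order = (1 : ℕ) := by
    rw [← hrank]; exact (hMTT hord f hf).1
  exact (PowerSeries.order_eq_nat.mp horder).1 h1

/-- **Item 19086 ⟸ `p`-adic BSD (bsd.S24) at the canonical datum on corner A2 + Perrin-Riou 1987 + GZK +
modularity — by VACUITY.** If at every pair of corner A2 the Mazur–Tate–Teitelbaum conjecture
`PAdicBSDConjecture W p Dh` holds for every canonical datum `Dh` (only clause (i), the order of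
vanishing, is used), then no such pair is degenerate (`not_pAdicBSDConjecture_of_degenerate`), so the
crux `SlopeDichotomyA2.DegenerateLocusA2` holds with its hypothesis never met. CONDITIONAL RESULT on a
named open conjecture of the tree (a parametrised `def`, taken on A2 as an explicit hypothesis); credits
nothing. Reading for the frontier ledger: a NON-vacuous instance of item 19086 is a counterexample to
`p`-adic BSD (i) inside A2. [cite: MazurTateTeitelbaum1986Invent, §II.10 Conj. BSD(p) (i)]
[cite: PerrinRiou1987, §1.4 Cor. 1.8] -/
theorem degenerateLocusA2_of_pAdicBSDConjecture (hPR : perrinRiou_rankOne_leadingTerms_odd)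
    (hGZK : rank_eq_analyticRank_of_analyticRank_le_one) (hmod : exists_isNewformOf)
    (hMTT : ∀ (W : WeierstrassCurve ℚ) [W.IsElliptic] [W.IsGloballyMinimal] (p : ℕ) [Fact p.Prime],
      X1.TypeBRankOne W p → ∀ Dh : PAdicHeightData W p, Dh.IsCanonical → PAdicBSDConjecture W p Dh) :
    SlopeDichotomyA2.DegenerateLocusA2 := by
  intro W _ _ p _ hB hdeg
  obtain ⟨Dh, hDh, _⟩ := id hdeg
  exact ((not_pAdicBSDConjecture_of_degenerate hPR hGZK hmod W p hB hdeg Dh)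
    (hMTT W p hB Dh hDh)).elim

/-- **The rung-I1 leaf ⟸ `p`-adic BSD (i) at the canonical datum on corner A2 + the α-road's six
published inputs.** Under the same vacuity every A2 pair carries its Schneider certificate, so the
kernel's cyclotomic road `X1.bsdp_of_typeBRankOne_of_schneider` (re-keyed as
`SchneiderWeaken.leaf_of_rider`: Greenberg–Vatsal, Schneider 1985/BMS, Perrin-Riou 1987, modularity, GZK;
its Mazur–Tate `σ` input is DISCHARGED by the tree theorem
`X1.PadicSigmaThree.mazur_tate_sigma_exists_odd_holds`) gives `BSD(E,p)` on all of A2 — the leaf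
`SchneiderWeaken.TypeBRankOneUnridered`.
CONDITIONAL RESULT; credits nothing; recorded so that the ledger shows rung I1-weaken below bsd.S24 (i)
on A2 by name. [cite: MazurTateTeitelbaum1986Invent, §II.10 Conj. BSD(p) (i)]
[cite: GreenbergVatsal2000, Thm. (1.3)] [cite: PerrinRiou1987, §1.4 Cor. 1.8] -/
theorem typeBRankOneUnridered_of_pAdicBSDConjecture
    (hGV : GreenbergVatsal2000.thm13_charIdeal_eq_of_gvPar)
    (hS : Schneider1985_order_charGenerator_odd) (hPR : perrinRiou_rankOne_leadingTerms_odd)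
    (hmodP : nonempty_modularParametrizationData)
    (hmod : exists_isNewformOf) (hGZK : rank_eq_analyticRank_of_analyticRank_le_one)
    (hMTT : ∀ (W : WeierstrassCurve ℚ) [W.IsElliptic] [W.IsGloballyMinimal] (p : ℕ) [Fact p.Prime],
      X1.TypeBRankOne W p → ∀ Dh : PAdicHeightData W p, Dh.IsCanonical → PAdicBSDConjecture W p Dh) :
    SchneiderWeaken.TypeBRankOneUnridered :=
  SchneiderWeaken.leaf_of_rider hGV hS hPR X1.PadicSigmaThree.mazur_tate_sigma_exists_odd_holds hmodP
    hGZK fun W _ _ p _ hB Dh hDh ↦ by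
    by_contra hnot
    exact not_pAdicBSDConjecture_of_degenerate hPR hGZK hmod W p hB ⟨Dh, hDh, hnot⟩ Dh
      (hMTT W p hB Dh hDh)

/-- **THE ANALYTIC FACE OF THE CRUX (companion of gen 0's `degenerateLocusA2_iff_concrete`).** Granted
Perrin-Riou 1987 at odd `p` (`hPR`), GZK (`hGZK`) and modularity (`hmod`, a newform of level `N_E`),
the crux `SlopeDichotomyA2.DegenerateLocusA2` is EQUIVALENT to: «`BSD(E,p)` at every pair of corner A2 at
which the LINEAR coefficient of `L_p(f,α,T)` vanishes for every newform `f` of `E`» — i.e. (the constant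
term vanishing for free, `constantCoeff_padicLFunction_eq_zero_of_typeBRankOne`) at the A2 pairs with
`ord_{T=0} L_p(E,α,T) ≥ 2 > 1 = r_an`, the failure set of `p`-adic BSD (i). (→) THE canonical datum
exists at every odd good ordinary `p` (`X1.PadicSigmaThree.exists_isCanonical_odd`, a tree theorem: the
Mazur–Tate `σ` at odd `p` is proved) and is degenerate by `not_schneider_iff_coeff_one_eq_zero`;
(←) a degenerate canonical datum forces `[T¹] = 0` for every newform. So gen 0's height-side number
(`canonicalPAdicHeight p P` of an admissible point) and x1a's certificate number (`[T¹]` of the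
unit-root `p`-adic `L`-series, the instrument of `X1.schneider_of_coeff_one_ne_zero_odd`) cut out the
SAME locus, and either non-vanishing certificate empties the crux at a pair.
[cite: PerrinRiou1987, §1.4 Cor. 1.8] [cite: MazurTateTeitelbaum1986Invent, §II.10 Conj. BSD(p) (i)]
[cite: MazurSteinTate2006, Thm. 1.3] -/
theorem degenerateLocusA2_iff_coeffOne (hPR : perrinRiou_rankOne_leadingTerms_odd)
    (hGZK : rank_eq_analyticRank_of_analyticRank_le_one) (hmod : exists_isNewformOf) :
    SlopeDichotomyA2.DegenerateLocusA2 ↔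
    ∀ (W : WeierstrassCurve ℚ) [W.IsElliptic] [W.IsGloballyMinimal] (p : ℕ) [Fact p.Prime],
      X1.TypeBRankOne W p →
      (∀ ⦃N : ℕ⦄ [NeZero N] (f : CuspForm (Gamma0 N) 2), IsNewformOf W f →
        PowerSeries.coeff 1 (padicLFunction f (unitRoot W p : ℚ_[p])) = 0) → BSDp W p := by
  constructor
  · intro h2 W _ _ p _ hB hcoeff
    have hX := isClassX1_of_classX1 hB.1
    haveI : NeZero (W.conductorNorm ℤ) := ⟨(W.conductorNorm_pos_holds).ne'⟩
    obtain ⟨f, hf⟩ := hmod W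
    obtain ⟨Dh, hDh⟩ := X1.PadicSigmaThree.exists_isCanonical_odd W p hX.two_ne
      hX.hasGoodReductionAtPrime hX.not_dvd_frobeniusTrace
    exact h2 W p hB ⟨Dh, hDh,
      (not_schneider_iff_coeff_one_eq_zero hPR hGZK W p hB Dh hDh f hf).mpr (hcoeff f hf)⟩
  · intro h W _ _ p _ hB hdeg
    obtain ⟨Dh, hDh, hnot⟩ := hdeg
    exact h W p hB fun N _ f hf ↦
      (not_schneider_iff_coeff_one_eq_zero hPR hGZK W p hB Dh hDh f hf).mp hnot

end Summit.BirchSwinnertonDyer.BirchSwinnertonDyer.Theorems.DegenerateLocusA2PrintPlacement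

end
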